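import Summits.PneNP.PneNP.Theorems.ChebyshevTracialDesignNowhereZeroPadding
import HarnessLib

/-!
# Cell pnp-psdrank, route `ChebyshevTracialDesign`: NOWHERE-ZERO PADDING COSTS TWO DIMENSIONS — 'no zero operator' is not a simplification at ANY
# dimension `r ≥ 3` (crux `TracialDecayExp20`, stmt-PneNP-19878)

Brick 80b (prover g14, after eng g15's remark MEMO-15(eng) §4(b) / STATUS 22:38Z). Brick 80 padded a tight psd rectangle by `ε` times the slack
strategy (dimension `+C(n+1,2)+1`, value `+ε·s`, constant `a ↦ a/2`). The engine seat observed that TWO fresh coordinates suffice and the value is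
unchanged: on `ℝ^r ⊕ ℝ²` put `X'_U = X_U ⊕ [X_U = 0]·E₁₁`, `Y'_M = Y_M ⊕ [Y_M = 0]·E₂₂`; since `E₁₁ E₂₂ = 0` the pads never interact, so `(X',Y')` is
tight-orthogonal, has NO zero operator, and `tr(X'_U Y'_M) = tr(X_U Y_M)` for every pair (`exists_padded_two`). Consequences typed here:
* `tracialValueLEAt_of_nowhereZero_two` — for every weight `W` and `r ≥ 1`: if every nowhere-zero tight psd rectangle of dimension `r + 2` has
  normalised value `≤ γ`, then `TracialValueLEAt W ((r+2)/r · γ) r`; unnormalised: the two suprema coincide (`sum_le_of_nowhereZero_two`).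
* brick 80's `tracialDecayExp20_of_nowhereZero` (nowhere-zero crux body, constant `a` ⇒ crux body, constant `a/2`) is thereby re-derivable with
  no `ε` and no slack strategy (not restated: same statement).
* §7 (appended) `exists_unit_exact_pad` — the same pad in the LABELLING currency of bricks 76/78: unit vectors `u, v` orthogonal on the ACTIVE tight
  pairs with weights `x, y ∈ [0,1]` become UNIT vectors in `ℝ^{r+2}` orthogonal on EVERY tight pair, with `⟨u',v'⟩² = x y ⟨u,v⟩²`.
So 'exact / fully active' (bricks 76/79) is not a simplification at any `r ≥ 3`: nowhere-zero `r = 5` ⊇ general `r = 3`, nowhere-zero `r = 4` ⊇ general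
`r = 2`, nowhere-zero `r = 3` ⊇ general `r = 1` (consistent with brick 79, whose bound IS the `r = 1` bound).
[cite: BrietDadushPokutta2014, Thm. 6 (§3)] [cite: Rothvoss2017, §2 (PDF p. 6)]
Stature: support/instrument (a reduction between two forms of the OPEN crux; credit for the two-coordinate pad: eng g15).
WHAT THIS IS NOT: no bound on any value, nothing on psd rank of P_PM(K_n), no P-vs-NP content.
-/

set_option linter.dupNamespace false -- `Summit.PneNP.PneNP.…`: summit = sub-problem (D-0017)

noncomputable section

namespace Summit.PneNP.PneNP.Theorems.ChebyshevTracialDesignNowhereZeroPadding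

open Finset Matrix Literature.Barriers.PneNP Literature.Combinatorics.Optimization
open Summit.PneNP.PneNP.Theorems.ChebyshevTracialDesignPureStateReduction

/-! ### §5 Two fresh coordinates -/

section Two

variable {n : ℕ}

/-- A block-diagonal matrix with a nonzero FIRST block is nonzero. -/
theorem fromBlocks_diag_ne_zero_left {l m : Type*} {A : Matrix l l ℝ} {D : Matrix m m ℝ} (hA : A ≠ 0) : fromBlocks A 0 0 D ≠ 0 := by
  intro h; rw [← fromBlocks_zero, fromBlocks_inj] at h; exact hA h.1

/-- The two coordinate pads never interact: `([X_U = 0]·E₁₁)([Y_M = 0]·E₂₂) = 0` for EVERY pair. -/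
theorem coordPad_mul_eq_zero {r : ℕ} (X : OddSet n → Matrix (Fin r) (Fin r) ℝ) (Y : PMatch n → Matrix (Fin r) (Fin r) ℝ)
    [∀ U, Decidable (X U = 0)] [∀ M, Decidable (Y M = 0)] (U : OddSet n) (M : PMatch n) :
    (if X U = 0 then vecMulVec (Pi.single 0 1 : Fin 2 → ℝ) (Pi.single 0 1 : Fin 2 → ℝ) else 0) *
      (if Y M = 0 then vecMulVec (Pi.single 1 1 : Fin 2 → ℝ) (Pi.single 1 1 : Fin 2 → ℝ) else 0) = 0 := by
  have h01 : (Pi.single 0 1 : Fin 2 → ℝ) ⬝ᵥ (Pi.single 1 1 : Fin 2 → ℝ) = 0 := by simp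
  split_ifs
  · exact vecMulVec_mul_vecMulVec_eq_zero h01
  all_goals simp

/-- **The two-coordinate pad.** On `ℝ²` the coordinate projections `E₁₁`, `E₂₂` form a tight-orthogonal psd rectangle for ANY activity pattern:
`P_U = [X_U = 0]·E₁₁`, `Q_M = [Y_M = 0]·E₂₂` satisfy `P_U Q_M = 0` for every pair, and `P_U ≠ 0` exactly where `X_U = 0`. -/
theorem isPsdRect_coordPad {r : ℕ} (X : OddSet n → Matrix (Fin r) (Fin r) ℝ) (Y : PMatch n → Matrix (Fin r) (Fin r) ℝ) [∀ U, Decidable (X U = 0)]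
    [∀ M, Decidable (Y M = 0)] :
    IsPsdRect (fun U => if X U = 0 then vecMulVec (Pi.single 0 1 : Fin 2 → ℝ) (Pi.single 0 1 : Fin 2 → ℝ) else 0)
      (fun M => if Y M = 0 then vecMulVec (Pi.single 1 1 : Fin 2 → ℝ) (Pi.single 1 1 : Fin 2 → ℝ) else 0) := by
  have h0 : (Pi.single 0 1 : Fin 2 → ℝ) ⬝ᵥ (Pi.single 0 1 : Fin 2 → ℝ) = 1 := by simp
  have h1 : (Pi.single 1 1 : Fin 2 → ℝ) ⬝ᵥ (Pi.single 1 1 : Fin 2 → ℝ) = 1 := by simp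
  refine ⟨fun U => ?_, fun M => ?_, fun U M _ => coordPad_mul_eq_zero X Y U M⟩
  · by_cases hU : X U = 0
    · simp only [hU, if_true]; exact ⟨posSemidef_vecMulVec _, posSemidef_one_sub_vecMulVec h0.le⟩
    · simp only [hU, if_false, sub_zero]; exact ⟨PosSemidef.zero, PosSemidef.one⟩
  · by_cases hM : Y M = 0
    · simp only [hM, if_true]; exact ⟨posSemidef_vecMulVec _, posSemidef_one_sub_vecMulVec h1.le⟩
    · simp only [hM, if_false, sub_zero]; exact ⟨PosSemidef.zero, PosSemidef.one⟩

/-- **PADDING BY TWO COORDINATES (eng g15).** Every tight-orthogonal psd rectangle `(X,Y)` of dimension `r` has a padding `(X',Y')` of dimension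
`r + 2` that is tight-orthogonal, has NO zero operator, and has THE SAME value kernel `tr(X'_U Y'_M) = tr(X_U Y_M)` for every pair.
[cite: BrietDadushPokutta2014, Thm. 6 (§3)] -/
theorem exists_padded_two {r : ℕ} {X : OddSet n → Matrix (Fin r) (Fin r) ℝ} {Y : PMatch n → Matrix (Fin r) (Fin r) ℝ} (hXY : IsPsdRect X Y) :
    ∃ (X' : OddSet n → Matrix (Fin (r + 2)) (Fin (r + 2)) ℝ) (Y' : PMatch n → Matrix (Fin (r + 2)) (Fin (r + 2)) ℝ),
      IsPsdRect X' Y' ∧ (∀ U, X' U ≠ 0) ∧ (∀ M, Y' M ≠ 0) ∧ ∀ U M, (X' U * Y' M).trace = (X U * Y M).trace := by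
  classical
  set e : Fin (r + 2) ≃ Fin r ⊕ Fin 2 := finSumFinEquiv.symm with he
  have hPQ := isPsdRect_coordPad X Y
  have hv0 : vecMulVec (Pi.single 0 1 : Fin 2 → ℝ) (Pi.single 0 1 : Fin 2 → ℝ) ≠ 0 := by
    rw [Ne, vecMulVec_eq_zero, or_self]; intro h; have := congrFun h 0; simp at this
  have hv1 : vecMulVec (Pi.single 1 1 : Fin 2 → ℝ) (Pi.single 1 1 : Fin 2 → ℝ) ≠ 0 := by
    rw [Ne, vecMulVec_eq_zero, or_self]; intro h; have := congrFun h 1; simp at this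
  refine ⟨fun U => (fromBlocks (X U) 0 0 (if X U = 0 then vecMulVec (Pi.single 0 1 : Fin 2 → ℝ) (Pi.single 0 1 : Fin 2 → ℝ) else 0)).submatrix e e,
    fun M => (fromBlocks (Y M) 0 0 (if Y M = 0 then vecMulVec (Pi.single 1 1 : Fin 2 → ℝ) (Pi.single 1 1 : Fin 2 → ℝ) else 0)).submatrix e e,
    isPsdRect_pad e hXY hPQ, fun U => ?_, fun M => ?_, fun U M => ?_⟩
  · by_cases hU : X U = 0
    · refine submatrix_equiv_ne_zero e (fromBlocks_diag_ne_zero ?_); rw [if_pos hU]; exact hv0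
    · exact submatrix_equiv_ne_zero e (fromBlocks_diag_ne_zero_left hU)
  · by_cases hM : Y M = 0
    · refine submatrix_equiv_ne_zero e (fromBlocks_diag_ne_zero ?_); rw [if_pos hM]; exact hv1
    · exact submatrix_equiv_ne_zero e (fromBlocks_diag_ne_zero_left hM)
  · rw [trace_pad_mul_pad, coordPad_mul_eq_zero X Y U M, trace_zero, add_zero]

end Two

/-! ### §6 The reductions with two extra dimensions -/

section ReductionTwo

variable {n : ℕ}

/-- **Unnormalised values: nowhere-zero strategies of dimension `r + 2` dominate all strategies of dimension `r`.** If `Σ W tr(X'Y') ≤ Γ` for every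
nowhere-zero tight psd rectangle of dimension `r + 2`, then `Σ W tr(XY) ≤ Γ` for every tight psd rectangle of dimension `r`.
[cite: BrietDadushPokutta2014, Thm. 6 (§3)] -/
theorem sum_le_of_nowhereZero_two (W : OddSet n → PMatch n → ℝ) {r : ℕ} (Γ : ℝ)
    (h : ∀ (X' : OddSet n → Matrix (Fin (r + 2)) (Fin (r + 2)) ℝ) (Y' : PMatch n → Matrix (Fin (r + 2)) (Fin (r + 2)) ℝ),
      IsPsdRect X' Y' → (∀ U, X' U ≠ 0) → (∀ M, Y' M ≠ 0) → ∑ U, ∑ M, W U M * (X' U * Y' M).trace ≤ Γ)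
    {X : OddSet n → Matrix (Fin r) (Fin r) ℝ} {Y : PMatch n → Matrix (Fin r) (Fin r) ℝ} (hXY : IsPsdRect X Y) :
    ∑ U, ∑ M, W U M * (X U * Y M).trace ≤ Γ := by
  obtain ⟨X', Y', hXY', hX', hY', htr⟩ := exists_padded_two hXY
  have h1 := h X' Y' hXY' hX' hY'
  simpa only [htr] using h1

/-- **Normalised values.** If every nowhere-zero tight psd rectangle of dimension `r + 2` has normalised value `≤ γ` against `W`, then
`TracialValueLEAt W ((r+2)/r · γ) r` (`r ≥ 1`). [cite: BrietDadushPokutta2014, Thm. 6 (§3)] [cite: GriblingDelaatLaurent2019, §5] -/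
theorem tracialValueLEAt_of_nowhereZero_two (W : OddSet n → PMatch n → ℝ) {r : ℕ} (hr : 0 < r) (γ : ℝ)
    (h : ∀ (X' : OddSet n → Matrix (Fin (r + 2)) (Fin (r + 2)) ℝ) (Y' : PMatch n → Matrix (Fin (r + 2)) (Fin (r + 2)) ℝ),
      IsPsdRect X' Y' → (∀ U, X' U ≠ 0) → (∀ M, Y' M ≠ 0) →
        (∑ U, ∑ M, W U M * (X' U * Y' M).trace) / ((r + 2 : ℕ) : ℝ) ≤ γ) :
    TracialValueLEAt W (((r : ℝ) + 2) / r * γ) r := by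
  intro X Y hXY
  have hr2 : (0 : ℝ) < ((r + 2 : ℕ) : ℝ) := by positivity
  have hle := sum_le_of_nowhereZero_two W (((r : ℝ) + 2) * γ) (fun X' Y' h1 h2 h3 => by
    have h4 := h X' Y' h1 h2 h3
    rw [div_le_iff₀ hr2] at h4
    push_cast at h4
    linarith) hXY
  have hr' : (0 : ℝ) < r := by exact_mod_cast hr
  rw [div_le_iff₀ hr']
  calc ∑ U, ∑ M, W U M * (X U * Y M).trace ≤ ((r : ℝ) + 2) * γ := hle
    _ = ((r : ℝ) + 2) / r * γ * r := by field_simp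

/-! Remark. Brick 80's `tracialDecayExp20_of_nowhereZero` (nowhere-zero crux body with constant `a` ⇒ crux body with constant `a/2`) follows from
`sum_le_of_nowhereZero_two` as well (only `(r+2)² ≤ 9r²` and `(r+2)/r ≤ 3 ≤ exp(a·dq n/2)` are absorbed); the statement is already in the tree, so it is
not re-proved here (dedup). -/

end ReductionTwo

/-! ### §7 (appended) The same pad in labelling currency: UNIT EXACT labellings of dimension `r + 2` contain every rank-one strategy of dimension `r` -/

section PureTwo

variable {n r : ℕ}

/-- `a ⊕ (α, 0)` against `b ⊕ (0, β)` on `Fin r ⊕ Fin 2` pairs to `⟨a, b⟩`: the two fresh coordinates never meet. -/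
theorem pad_dotProduct_cross (a b : Fin r → ℝ) (α β : ℝ) :
    Sum.elim a (Pi.single (0 : Fin 2) α) ⬝ᵥ Sum.elim b (Pi.single (1 : Fin 2) β) = a ⬝ᵥ b := by
  rw [sumElim_dotProduct_sumElim]; simp

/-- `a ⊕ (Pi.single i α)` has squared norm `‖a‖² + α²`. -/
theorem pad_dotProduct_self (a : Fin r → ℝ) (i : Fin 2) (α : ℝ) :
    Sum.elim a (Pi.single i α) ⬝ᵥ Sum.elim a (Pi.single i α) = a ⬝ᵥ a + α * α := by
  rw [sumElim_dotProduct_sumElim]; simp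

/-- Re-indexing both vectors along an equivalence preserves the dot product. -/
theorem dotProduct_comp_equiv {σ τ : Type*} [Fintype σ] [Fintype τ] (e : τ ≃ σ) (f g : σ → ℝ) : (f ∘ e) ⬝ᵥ (g ∘ e) = f ⬝ᵥ g :=
  e.sum_comp (fun i => f i * g i)

/-- **UNIT EXACT PADDING (labelling currency of bricks 76/78).** Let `u_U, v_M ∈ ℝ^r` be unit vectors and `x_U, y_M ∈ [0,1]` weights such that
`u_U ⊥ v_M` on every ACTIVE tight pair of a `t`-cut (`cc(U,M) = 1`, `x_U ≠ 0`, `y_M ≠ 0`). Then there are UNIT vectors `u'_U, v'_M ∈ ℝ^{r+2}`, orthogonal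
on EVERY tight pair of a `t`-cut (an EXACT labelling in the sense of brick 76), with `⟨u'_U, v'_M⟩² = x_U y_M ⟨u_U, v_M⟩²` for all pairs
(`u' = √x·u ⊕ (√(1−x), 0)`, `v' = √y·v ⊕ (0, √(1−y))`): the rank-one dense cell of dimension `r` with its activity pattern is, kernel for kernel, an
exact unit labelling of dimension `r + 2`. So `exact_rankOne_dim_three_le` (brick 76, dimension 3, bound `γ`) contains the case `r = 1` of the active
rank-one cell, and a dimension-5 analogue of it would be the full active rank-one cell at `r = 3`. [cite: BrietDadushPokutta2014, Thm. 6 (§3)] -/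
theorem exists_unit_exact_pad {t : ℕ} (x : OddSet n → ℝ) (y : PMatch n → ℝ) (hx : ∀ U, 0 ≤ x U ∧ x U ≤ 1) (hy : ∀ M, 0 ≤ y M ∧ y M ≤ 1)
    (u : OddSet n → Fin r → ℝ) (v : PMatch n → Fin r → ℝ) (hu : ∀ U, u U ⬝ᵥ u U = 1) (hv : ∀ M, v M ⬝ᵥ v M = 1)
    (horth : ∀ U M, U.1.card = t → cc U M = 1 → x U ≠ 0 → y M ≠ 0 → u U ⬝ᵥ v M = 0) :
    ∃ (u' : OddSet n → Fin (r + 2) → ℝ) (v' : PMatch n → Fin (r + 2) → ℝ), (∀ U, u' U ⬝ᵥ u' U = 1) ∧ (∀ M, v' M ⬝ᵥ v' M = 1) ∧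
      (∀ U M, U.1.card = t → cc U M = 1 → u' U ⬝ᵥ v' M = 0) ∧ ∀ U M, (u' U ⬝ᵥ v' M) ^ 2 = x U * y M * (u U ⬝ᵥ v M) ^ 2 := by
  set e : Fin (r + 2) ≃ Fin r ⊕ Fin 2 := finSumFinEquiv.symm with he
  set a : OddSet n → Fin r ⊕ Fin 2 → ℝ := fun U => Sum.elim (Real.sqrt (x U) • u U) (Pi.single (0 : Fin 2) (Real.sqrt (1 - x U))) with ha
  set b : PMatch n → Fin r ⊕ Fin 2 → ℝ := fun M => Sum.elim (Real.sqrt (y M) • v M) (Pi.single (1 : Fin 2) (Real.sqrt (1 - y M))) with hb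
  have hab : ∀ U M, a U ⬝ᵥ b M = Real.sqrt (x U) * Real.sqrt (y M) * (u U ⬝ᵥ v M) := fun U M => by
    rw [ha, hb]; dsimp only
    rw [pad_dotProduct_cross, smul_dotProduct, dotProduct_smul, smul_eq_mul, smul_eq_mul]; ring
  have haa : ∀ U, a U ⬝ᵥ a U = 1 := fun U => by
    rw [ha]; dsimp only
    rw [pad_dotProduct_self, smul_dotProduct, dotProduct_smul, hu U, smul_eq_mul, smul_eq_mul, mul_one,
      Real.mul_self_sqrt (hx U).1, Real.mul_self_sqrt (by linarith [(hx U).2])]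
    ring
  have hbb : ∀ M, b M ⬝ᵥ b M = 1 := fun M => by
    rw [hb]; dsimp only
    rw [pad_dotProduct_self, smul_dotProduct, dotProduct_smul, hv M, smul_eq_mul, smul_eq_mul, mul_one,
      Real.mul_self_sqrt (hy M).1, Real.mul_self_sqrt (by linarith [(hy M).2])]
    ring
  refine ⟨fun U => a U ∘ e, fun M => b M ∘ e, fun U => by rw [dotProduct_comp_equiv, haa], fun M => by rw [dotProduct_comp_equiv, hbb],
    fun U M hU hUM => ?_, fun U M => ?_⟩
  · rw [dotProduct_comp_equiv, hab]
    by_cases hxU : x U = 0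
    · rw [hxU, Real.sqrt_zero]; ring
    by_cases hyM : y M = 0
    · rw [hyM, Real.sqrt_zero]; ring
    rw [horth U M hU hUM hxU hyM, mul_zero]
  · rw [dotProduct_comp_equiv, hab, mul_pow, mul_pow, Real.sq_sqrt (hx U).1, Real.sq_sqrt (hy M).1]

end PureTwo

end Summit.PneNP.PneNP.Theorems.ChebyshevTracialDesignNowhereZeroPadding
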